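import Literature.MathematicalPhysics.QuantumFieldTheory.Balaban1983to89.Beta.PlaquetteVertex

/-!
# `Beta.PlaquetteWeitzenbock` — the lattice Weitzenböck identity at `B`-linear order: the transport form of the Wilson
# `(2,1)`-jet is twice the covariant-gradient germ minus twice the covariant-divergence germ plus ONE far-corner spin unit;
# both spin units of `SpinTable`'s model vector vertex DERIVED (`s = −2`, `s² = 4`)

HONEST FRAMING (cell `pub-balaban`, β sub-cell, analysis prover AN3, generation 11, second node).  Discharging `BetaPertH`
would make Bałaban's ultraviolet stability UNCONDITIONAL — a real constructive-QFT result; it is NOT the continuum limit and NOT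
the Clay problem.  This file discharges nothing of the kind: it is FINITE NON-COMMUTATIVE ALGEBRA on a finite periodic lattice
(summation by parts, cyclicity of a tracial functional, antisymmetrisation), kernel-checked, continuing `Beta.PlaquetteVertex`.
Value = a kernel certificate for the β-function bookkeeping «which term of the ACTUAL plaquette action produces which table
coefficient» (the `(D1-rep)` dictionary of the cell), NOT summit progress.

ABSOLUTE RULE.  No internally-minted statement enters as a cited fact.  Every statement below is kernel-proved; the only
literature loci named (T. Bałaban, *Propagators for lattice gauge theories in a background field*, Comm. Math. Phys. **99**
(1985) 389–434 [Balaban1985BackgroundPropagators] = cell paper B9, pp. 390–392, 395; *Renormalization group approach to lattice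
gauge field theories. I*, Comm. Math. Phys. **109** (1987) 249–301 [Balaban1987RG1] = B12, p. 260) are CONTEXT for the reader —
which printed objects these forms are the first-order germs of — and nothing printed is used as a hypothesis.  The manuscripts
under audit are not citable for their disputed steps and are not cited for any step here.

## What is printed (context only; B9 read from the OCR pages `p0002`–`p0004` of `paper:balaban1985-cmp99-background-propagators`,
## the same loci `Beta.PlaquetteVertex` and `B8CurlGradHolonomy` quote)

B9 p. 390: «Let us recall that R(U)X = UXU⁻¹.» and the covariant derivative of a site function
«(D^η_{U₀}A)(b) = η⁻¹(R(U₀(b))A(b₊) − A(b₋))» (transport from `b₊` back to `b₋`).  B9 p. 391 (3.4): for a bond function `A` and the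
plaquette `p = ⟨x, y, z, w⟩`, «(D^η_{U₀}A)(p) = η⁻¹(A(x, y) + R(U₀(x, y))A(y, z) + R(U₀(x, w))A(z, w) + A(w, x))», and for
`p = p_{μν}(x)` «(D^η_{U₀}A)_{μν}(x) = (D^η_{U₀,μ}A_ν)(x) − (D^η_{U₀,ν}A_μ)(x)»; (3.5) «A(x, x′) = −A(x′, x)».  B9 p. 392 (3.8):
the adjoint `D*` on bond functions, «(D*A)(x) = Σ_{μ=1}^{d} η⁻¹(R(U(x, x − ηe_μ))A(x − ηe_μ, x) − A(x, x + ηe_μ))»; (3.10): the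
quadratic form `⟨A, ΔA⟩ = ⟨A, D*DA⟩ + ⟨A, Δ′A⟩` with the explicit plaquette commutator term; p. 395 (3.26): `Δ_a = Δ + DRD* + Q*aQ`
(the longitudinal completion).  B12 p. 260 (1.5): the same operator one renormalisation step up.  NOTHING of this is asserted.

## What is certified (kernel; [folklore] lattice gauge calculus at first order in the background)

Setting of `Beta.PlaquetteVertex` §2: a ring `𝔸` with a linear functional `τ` (tracial where stated), a finite periodic lattice
`Λ` (an additive commutative group) with frame `e : D → Λ`, fluctuation letters `W : Λ → D → 𝔸`, background letters `B`, the lattice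
curl `lcurl`, `F = lcurl e B`, and the three forms of `jet21_split : jet21 = spinLocal + ½·spinDiff + transport`.

* §1–§2 THE SPLIT OF THE TRANSPORT FORM (`PlaquetteVertex.twistW_regroup`, summed): `transport = transportMin − transportF` with
  `transportMin = Σ_x Σ_{(μ,ν)} τ(Z_{μν}(x)·([B_μ(x), W_ν(x+e_μ)] − [B_ν(x), W_μ(x+e_ν)]))` (`Z = lcurl e W`) — the cross term of the
  square of the FIRST-ORDER COVARIANT CURL `covCurl₁ = Z + covCurlGerm` (`sum_covCurl₁_sq`), i.e. the `B`-linear germ at `U₀ = 1` in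
  the direction `B` of `½Σ τ((D_{U₀}W)²_{μν})` for the covariant curl of B9 (3.4) with `R(e^{B}) = 1 + [B, ·] + …` (context) — and
  `transportF = Σ τ(Z_{μν}(x)·[F_{μν}(x), W_μ(x+e_ν) + W_ν(x)])` (grading (t) two, `PlaquetteVertex` header TWO GRADINGS).
* §2 **THE LATTICE WEITZENBÖCK IDENTITY AT `B`-LINEAR ORDER** (`transportMin_eq`, `τ` tracial, every `W`, `B`, `e`, every finite
  periodic `Λ`):

      transportMin = 2•gradGerm − 2•divGerm + spinFar,

  where `gradGerm = Σ_x Σ_μ Σ_ν τ((W_ν(x+e_μ) − W_ν(x))·[B_μ(x), W_ν(x+e_μ)])` is the cross term of the square of the first-order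
  covariant forward difference applied componentwise (`covGrad₁`, `sum_covGrad₁_sq`; transport from `b₊` to `b₋` as on B9 p. 390 and in
  `B8CurlGradHolonomy.covD`), `divGerm = Σ_x τ(divW(x)·Σ_μ [B_μ(x−e_μ), W_μ(x−e_μ)])`, `divW(x) = Σ_μ (W_μ(x) − W_μ(x−e_μ))`, is the
  cross term of the square of the first-order covariant (backward) divergence (`covDiv₁`, `sum_covDiv₁_sq`; cf. B9 (3.8)), and
  `spinFar = Σ_x Σ_{(μ,ν)} τ(F_{μν}(x)·[W_μ(x+e_ν), W_ν(x+e_μ)])` is the SPIN FORM READ AT THE TWO FAR BONDS of the plaquette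
  `p_{μν}(x)` (the bonds not touching `x`) — `= spinLocal + spinFarDiff`, `spinFarDiff` an explicit form with one more fluctuation
  difference (`spinFar_eq`, `farBracket_eq`).  Proof: antisymmetry of `Z` (`transportMin = 2•pairMin`), `Z = δ_μW_ν − δ_νW_μ`
  (`pairMin = gradGerm − crossGerm`), ONE summation by parts `x ↦ x + e_ν` with the lattice Leibniz rule and the cyclicity
  `τ(A·[X, C]) = τ(X·[C, A])` (`crossGerm = −halfSpin − longCross`), a second reindexing `x ↦ x + e_μ` (`longCross = −divGerm`), and
  antisymmetrisation in `(μ, ν)` (`2•halfSpin = spinFar`).  The identity was first found and checked with a translation-invariant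
  cyclic-word engine (`d = 2, 3`, residual `0`); the kernel proof is the certificate.  Read as `½·transportMin + divGerm = gradGerm +
  ½·spinFar` it is the lattice form, at `B`-linear order, of the continuum Weitzenböck bookkeeping the cell records as D-an2.2
  (`¼|d_Ba|² + ½|d_B*a|² = ½|∇_Ba|² + ½⟨a_ν,[F_{μν},a_μ]⟩`; context, not used): EXACT on the lattice once the curvature term is read at
  the far bonds — the whole lattice remainder of the Wilson jet sits in `spinFar − spinLocal` and `transportF`.
* §2 COROLLARIES: `transport_weitzenbock`, and for the Wilson jet (`PlaquetteVertex.jet21`, `𝕜 = ℝ` or `ℂ`, `τ` tracial)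
  `jet21_weitzenbock : jet21 = spinLocal + spinFar + ½•spinDiff + 2•gradGerm − 2•divGerm − transportF` — TWO spin forms with
  coefficient ONE each: the explicit plaquette-commutator unit (`spinLocal`, `PlaquetteVertex`) and the Weitzenböck unit (`spinFar`).
* §3 IN `SpinTable`'S COORDINATES (`W = field t v`, one-bond background `bondLetter z γ Y`, `τ : 𝔸 →ₗ[ℝ] ℝ` tracial, every `v`):
  `gradGerm_bondLetter : gradGerm τ e W (bondLetter z γ Y) = Σ_ν τ(Y·[W_ν(z), W_ν(z+e_γ)])` (pure hopping across the background
  bond, diagonal in the direction index), hence **`gradGerm_field_bondLetter : gradGerm = −½·v ⬝ᵥ (GhostTable.current z (e γ)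
  (copies D (adM Y)) *ᵥ v)`** — the covariant-gradient germ IS the antisymmetric lattice current of the `card D` copies, the first
  summand of `SpinTable.vecVertex`; and the HEADLINE **`actionJet21_eq_vecVertex`**: in the Hessian convention `S₂ = ½·vᵀHv` of
  `Σ_p (1 − Re τU(∂p))`,

      −½·jet21 = ½·v ⬝ᵥ (SpinTable.vecVertex (−2) e z γ (adM Y) *ᵥ v) + divGerm + R,
      R = −¼·spinDiff + ½·transportF − ½·spinFarDiff   (explicit forms, grading (t) ≥ 2, NOT estimated here),

  i.e. the Wilson action's `B`-linear one-bond Hessian germ IS `SpinTable` §4's MODEL vector vertex `current(copies A) + s•spinVertex`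
  at **`s = sTot = −2`**, so `s² = 4` and `2N²s² = 8N²` (`coeff_sq_sTot`, `SpinTable.coeff_sq_iff`): `PlaquetteVertex.coeff_sq_two_units`
  realised with `sTot = sExpl + sW`, `sExpl = −1` (explicit, `PlaquetteVertex`) and `sW = −1` (Weitzenböck, this file) — MODULO (a) the
  LONGITUDINAL germ `divGerm`, separated here and NOT eliminated (its disposal is the gauge fixing `DRD*` of B9 (3.26), the cell's
  an2 `(V-con)` side), and (b) the remainder `R`.  §4: Bałaban's letters verbatim (`𝔸 = Mat_N(ℂ)`, `τ = Re tr` normalised,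
  `t_c = iτ_c`): the colour matrix is `ColourTrace.adMat τ (τ_c)` (`PlaquetteVertex.adM_gen`) and `SpinTable.three_sectors_bf` holds
  verbatim with the DERIVED coupling (`three_sectors_bf_sTot`: `(−2)² = 2²`).
* NOT here: the `B`-quadratic `(2,2)` jets, the ghost sector (`GhostTable`), the constraint/averaging vertices, any estimate, any
  measure, any continuum statement.  NOT summit progress; NOT continuum, NOT Clay.
-/

namespace Literature.MathematicalPhysics.QuantumFieldTheory.Balaban1983to89.Beta.PlaquetteWeitzenbock

open Finset
open scoped BigOperators Matrix
open Literature.MathematicalPhysics.QuantumFieldTheory.Balaban1983to89.Beta.BubbleTable (elemIns elemIns_apply convKernel)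
open Literature.MathematicalPhysics.QuantumFieldTheory.Balaban1983to89.Beta.GhostTable (current copies cellForm mixedDiffFun)
open Literature.MathematicalPhysics.QuantumFieldTheory.Balaban1983to89.Beta.SpinTable (br spinVertex vecVertex coeff_sq_iff
  bfKernel bfKernel_eq_model three_sectors_gen)
open Literature.MathematicalPhysics.QuantumFieldTheory.Balaban1983to89.Beta.ColourTrace (adMat Complete TrOrthonormal)
open Literature.MathematicalPhysics.QuantumFieldTheory.Balaban1983to89.Beta.PlaquetteVertex

/-! ## §1 Ring-level lemmas: brackets, Leibniz, the cyclic bracket identity of a tracial functional -/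

section RingLevel

variable {R : Type*} [Ring R]

/-- `[X − X′, Y] = [X,Y] − [X′,Y]`. [folklore] -/
theorem br_sub_left (X X' Y : R) : br (X - X') Y = br X Y - br X' Y := by
  simp only [br]; noncomm_ring

/-- `[X, Y − Y′] = [X,Y] − [X,Y′]`. [folklore] -/
theorem br_sub_right (X Y Y' : R) : br X (Y - Y') = br X Y - br X Y' := by
  simp only [br]; noncomm_ring

/-- antisymmetry `[Y, X] = −[X, Y]`. [folklore] -/
theorem br_swap (X Y : R) : br Y X = -br X Y := by
  simp only [br]; abel

/-- `[0, Y] = 0`. [folklore] -/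
@[simp] theorem br_zero_left (Y : R) : br (0 : R) Y = 0 := by
  simp only [br, zero_mul, mul_zero, sub_self]

/-- `[X, X] = 0`. [folklore] -/
@[simp] theorem br_self (X : R) : br X X = 0 := by
  simp only [br, sub_self]

/-- the bracket is additive in its second slot over a finite sum. [folklore] -/
theorem br_sum_right {ι : Type*} (s : Finset ι) (X : R) (f : ι → R) :
    br X (∑ i ∈ s, f i) = ∑ i ∈ s, br X (f i) := by
  simp only [br, Finset.mul_sum, Finset.sum_mul, Finset.sum_sub_distrib]

/-- THE LATTICE LEIBNIZ RULE for a difference of brackets: `[B′,V′] − [B,V] = [B′ − B, V] + [B′, V′ − V]`. [folklore] -/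
theorem br_sub_br (B B' V V' : R) : br B' V' - br B V = br (B' - B) V + br B' (V' - V) := by
  simp only [br]; noncomm_ring

end RingLevel

section Traces

variable {𝕜 : Type*} [Semiring 𝕜] {𝔸 : Type*} [Ring 𝔸] [Module 𝕜 𝔸] {V : Type*} [AddCommGroup V] [Module 𝕜 V]

/-- **THE CYCLIC BRACKET IDENTITY** of a tracial functional: `τ(A·[X, C]) = τ(X·[C, A])`. [folklore] -/
theorem trace_mul_br_cycl (τ : 𝔸 →ₗ[𝕜] V) (hτ : ∀ a b : 𝔸, τ (a * b) = τ (b * a)) (A X C : 𝔸) :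
    τ (A * br X C) = τ (X * br C A) := by
  simp only [br, mul_sub, map_sub]
  rw [hτ A (X * C), mul_assoc, ← mul_assoc A C X, hτ (A * C) X, ← mul_assoc, ← mul_assoc]

/-- `τ(A·[X, A]) = 0`. [folklore] -/
theorem trace_mul_br_self (τ : 𝔸 →ₗ[𝕜] V) (hτ : ∀ a b : 𝔸, τ (a * b) = τ (b * a)) (A X : 𝔸) :
    τ (A * br X A) = 0 := by
  rw [trace_mul_br_cycl τ hτ, br_self, mul_zero, map_zero]

/-- the square of a sum under a tracial functional: `τ((a+c)²) = τ(a²) + 2•τ(ac) + τ(c²)` — the cross term is what the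
`B`-linear germs below are. [folklore] -/
theorem trace_sq_add (τ : 𝔸 →ₗ[𝕜] V) (hτ : ∀ a b : 𝔸, τ (a * b) = τ (b * a)) (a c : 𝔸) :
    τ ((a + c) * (a + c)) = τ (a * a) + 2 • τ (a * c) + τ (c * c) := by
  rw [add_mul, mul_add, mul_add, map_add, map_add, map_add, hτ c a, two_nsmul]
  abel

/-- pointwise form of the summation-by-parts step (§2 `crossGerm_eq`): for tracial `τ`,
`τ((W′ − W)·[B, V]) = −τ((B′ − B)·[V, W′]) − (τ(W·[B, V]) − τ(W′·[B′, V]))`. [folklore] -/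
theorem trace_cross_pointwise (τ : 𝔸 →ₗ[𝕜] V) (hτ : ∀ a b : 𝔸, τ (a * b) = τ (b * a)) (W W' B B' U : 𝔸) :
    τ ((W' - W) * br B U) = -τ ((B' - B) * br U W') - (τ (W * br B U) - τ (W' * br B' U)) := by
  have hc : τ (W' * br (B' - B) U) = τ ((B' - B) * br U W') := trace_mul_br_cycl τ hτ W' (B' - B) U
  rw [br_sub_left, mul_sub, map_sub] at hc
  rw [sub_mul, map_sub, ← hc]
  abel

/-- pointwise form of the antisymmetrisation step (§2 `two_halfSpin`): `τ(P·[V, U]) + τ(Q·[U, V]) = τ((Q − P)·[U, V])`. [folklore] -/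
theorem trace_antisymm_pointwise (τ : 𝔸 →ₗ[𝕜] V) (P Q U U' : 𝔸) :
    τ (P * br U' U) + τ (Q * br U U') = τ ((Q - P) * br U U') := by
  rw [br_swap U U', mul_neg, map_neg, sub_mul, map_sub]
  abel

end Traces

/-! ## §2 The forms and the lattice Weitzenböck identity at `B`-linear order -/

section Forms

variable {𝕜 : Type*} [Semiring 𝕜] {𝔸 : Type*} [Ring 𝔸] [Module 𝕜 𝔸] {V : Type*} [AddCommGroup V] [Module 𝕜 V]
variable {Λ : Type*} [Fintype Λ] [AddCommGroup Λ] {D : Type*} [Fintype D]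

/-- THE FIRST-ORDER COVARIANT-CURL GERM `[B_μ(x), W_ν(x+e_μ)] − [B_ν(x), W_μ(x+e_ν)]`: the `B`-linear part of B9 (3.4)'s covariant
curl `A_μ(x) + R(U₀(x,x+e_μ))A_ν(x+e_μ) − R(U₀(x,x+e_ν))A_μ(x+e_ν) − A_ν(x)` at `U₀ = 1` in the direction `B` with `R(e^B)X = X + [B,X] + …`
(context; each transported letter commuted with the background on the ONE bond from the base point to the letter's bond) —
the MINIMAL part of `PlaquetteVertex.twistW` (`twistW_regroup`). [folklore] -/
def covCurlGerm (e : D → Λ) (W B : Λ → D → 𝔸) (x : Λ) (μ ν : D) : 𝔸 :=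
  br (B x μ) (W (x + e μ) ν) - br (B x ν) (W (x + e ν) μ)

/-- THE MINIMAL TRANSPORT FORM `Σ_x Σ_{(μ,ν)} τ(Z_{μν}(x) · covCurlGerm)`, `Z = lcurl e W`. [folklore] -/
def transportMin (τ : 𝔸 →ₗ[𝕜] V) (e : D → Λ) (W B : Λ → D → 𝔸) : V :=
  ∑ x, ∑ μ, ∑ ν, τ (lcurl e W x μ ν * covCurlGerm e W B x μ ν)

/-- THE `F`-PART OF THE TRANSPORT FORM `Σ_x Σ_{(μ,ν)} τ(Z_{μν}(x) · [F_{μν}(x), W_μ(x+e_ν) + W_ν(x)])` (grading (t) two). [folklore] -/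
def transportF (τ : 𝔸 →ₗ[𝕜] V) (e : D → Λ) (W B : Λ → D → 𝔸) : V :=
  ∑ x, ∑ μ, ∑ ν, τ (lcurl e W x μ ν * br (lcurl e B x μ ν) (W (x + e ν) μ + W x ν))

/-- **THE SPLIT OF THE TRANSPORT FORM**: `transport = transportMin − transportF` (`PlaquetteVertex.twistW_regroup`, summed). [folklore] -/
theorem transport_split (τ : 𝔸 →ₗ[𝕜] V) (e : D → Λ) (W B : Λ → D → 𝔸) :
    transport τ e W B = transportMin τ e W B - transportF τ e W B := by
  simp only [transport, transportMin, transportF, ← Finset.sum_sub_distrib, ← map_sub, ← mul_sub]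
  refine Finset.sum_congr rfl fun x _ => Finset.sum_congr rfl fun μ _ => Finset.sum_congr rfl fun ν _ => ?_
  rw [twistW_regroup, covCurlGerm]

/-- THE COVARIANT-GRADIENT GERM `Σ_x Σ_μ Σ_ν τ((W_ν(x+e_μ) − W_ν(x))·[B_μ(x), W_ν(x+e_μ)])`: the cross term of the square of the
first-order covariant forward difference `covGrad₁` applied to every component (`sum_covGrad₁_sq`). [folklore] -/
def gradGerm (τ : 𝔸 →ₗ[𝕜] V) (e : D → Λ) (W B : Λ → D → 𝔸) : V :=
  ∑ x, ∑ μ, ∑ ν, τ ((W (x + e μ) ν - W x ν) * br (B x μ) (W (x + e μ) ν))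

/-- THE LATTICE DIVERGENCE `divW(x) = Σ_μ (W_μ(x) − W_μ(x − e_μ))` (net outflow at the site `x`). [folklore] -/
def divW (e : D → Λ) (W : Λ → D → 𝔸) (x : Λ) : 𝔸 := ∑ μ, (W x μ - W (x - e μ) μ)

/-- THE DIVERGENCE TWIST `Σ_μ [B_μ(x−e_μ), W_μ(x−e_μ)]`: the `B`-linear part of transporting each incoming letter `W_μ(x−e_μ)` forward to
`x` along its bond (`R(U₀(x, x−e_μ)) = R(e^{B_μ(x−e_μ)})⁻¹`, cf. B9 (3.8); context). [folklore] -/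
def divTwist (e : D → Λ) (W B : Λ → D → 𝔸) (x : Λ) : 𝔸 := ∑ μ, br (B (x - e μ) μ) (W (x - e μ) μ)

/-- THE COVARIANT-DIVERGENCE GERM `Σ_x τ(divW(x) · divTwist(x))`: the cross term of the square of the first-order covariant divergence
`covDiv₁ = divW + divTwist` (`sum_covDiv₁_sq`) — the LONGITUDINAL germ. [folklore] -/
def divGerm (τ : 𝔸 →ₗ[𝕜] V) (e : D → Λ) (W B : Λ → D → 𝔸) : V :=
  ∑ x, τ (divW e W x * divTwist e W B x)

/-- **THE FAR-CORNER SPIN FORM** `Σ_x Σ_{(μ,ν)} τ(F_{μν}(x) · [W_μ(x+e_ν), W_ν(x+e_μ)])`: the plaquette field against the commutator of the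
fluctuation letters on the two bonds of `p_{μν}(x)` NOT touching the base point (`spinLocal` reads the two bonds AT `x`). [folklore] -/
def spinFar (τ : 𝔸 →ₗ[𝕜] V) (e : D → Λ) (W B : Λ → D → 𝔸) : V :=
  ∑ x, ∑ μ, ∑ ν, τ (lcurl e B x μ ν * br (W (x + e ν) μ) (W (x + e μ) ν))

/-- the far-minus-local spin form `Σ τ(F_{μν}(x) · ([W_μ(x+e_ν), W_ν(x+e_μ)] − [W_μ(x), W_ν(x)]))` (grading (t) two: `farBracket_eq`).
[folklore] -/
def spinFarDiff (τ : 𝔸 →ₗ[𝕜] V) (e : D → Λ) (W B : Λ → D → 𝔸) : V :=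
  ∑ x, ∑ μ, ∑ ν, τ (lcurl e B x μ ν * (br (W (x + e ν) μ) (W (x + e μ) ν) - br (W x μ) (W x ν)))

omit [Fintype Λ] [Fintype D] in
/-- the far bracket minus the local bracket carries one fluctuation DIFFERENCE in each term:
`[W_μ(x+e_ν), W_ν(x+e_μ)] − [W_μ(x), W_ν(x)] = [W_μ(x+e_ν) − W_μ(x), W_ν(x+e_μ)] + [W_μ(x), W_ν(x+e_μ) − W_ν(x)]`. [folklore] -/
theorem farBracket_eq (e : D → Λ) (W : Λ → D → 𝔸) (x : Λ) (μ ν : D) :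
    br (W (x + e ν) μ) (W (x + e μ) ν) - br (W x μ) (W x ν) =
      br (W (x + e ν) μ - W x μ) (W (x + e μ) ν) + br (W x μ) (W (x + e μ) ν - W x ν) := by
  simp only [br]; noncomm_ring

/-- `spinFar = spinLocal + spinFarDiff`. [folklore] -/
theorem spinFar_eq (τ : 𝔸 →ₗ[𝕜] V) (e : D → Λ) (W B : Λ → D → 𝔸) :
    spinFar τ e W B = spinLocal τ e W B + spinFarDiff τ e W B := by
  simp only [spinFar, spinLocal, spinFarDiff, ← Finset.sum_add_distrib, ← map_add, ← mul_add, add_sub_cancel]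

/-! ### auxiliary forms of the proof -/

/-- auxiliary: `pairMin = Σ τ(Z_{μν}(x) · [B_μ(x), W_ν(x+e_μ)])` (one half of `transportMin` by antisymmetry). [folklore] -/
def pairMin (τ : 𝔸 →ₗ[𝕜] V) (e : D → Λ) (W B : Λ → D → 𝔸) : V :=
  ∑ x, ∑ μ, ∑ ν, τ (lcurl e W x μ ν * br (B x μ) (W (x + e μ) ν))

/-- auxiliary: `crossGerm = Σ τ((W_μ(x+e_ν) − W_μ(x)) · [B_μ(x), W_ν(x+e_μ)])` (the `δ_νW_μ` half of `Z` against the minimal twist).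
[folklore] -/
def crossGerm (τ : 𝔸 →ₗ[𝕜] V) (e : D → Λ) (W B : Λ → D → 𝔸) : V :=
  ∑ x, ∑ μ, ∑ ν, τ ((W (x + e ν) μ - W x μ) * br (B x μ) (W (x + e μ) ν))

/-- auxiliary: `halfSpin = Σ τ((B_μ(x+e_ν) − B_μ(x)) · [W_ν(x+e_μ), W_μ(x+e_ν)])` (`2•halfSpin = spinFar`). [folklore] -/
def halfSpin (τ : 𝔸 →ₗ[𝕜] V) (e : D → Λ) (W B : Λ → D → 𝔸) : V :=
  ∑ x, ∑ μ, ∑ ν, τ ((B (x + e ν) μ - B x μ) * br (W (x + e μ) ν) (W (x + e ν) μ))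

/-- auxiliary: `longCross = Σ_x Σ_μ τ(W_μ(x) · [B_μ(x), divW(x + e_μ)])` (`= −divGerm`). [folklore] -/
def longCross (τ : 𝔸 →ₗ[𝕜] V) (e : D → Λ) (W B : Λ → D → 𝔸) : V :=
  ∑ x, ∑ μ, τ (W x μ * br (B x μ) (divW e W (x + e μ)))

omit [Fintype D] in
/-- reindexing a lattice sum by a translation (the lattice is a finite group: periodic boundary conditions). [folklore] -/
theorem sum_shift (a : Λ) (f : Λ → V) : ∑ x, f (x + a) = ∑ x, f x :=
  Equiv.sum_comp (Equiv.addRight a) f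

omit [AddCommGroup Λ] in
/-- sum bookkeeping `Σ_x Σ_μ Σ_ν = Σ_μ Σ_ν Σ_x`. [folklore] -/
theorem sum_x_comm₃ (f : Λ → D → D → V) : ∑ x, ∑ μ, ∑ ν, f x μ ν = ∑ μ, ∑ ν, ∑ x, f x μ ν := by
  calc ∑ x, ∑ μ, ∑ ν, f x μ ν = ∑ μ, ∑ x, ∑ ν, f x μ ν := Finset.sum_comm
    _ = ∑ μ, ∑ ν, ∑ x, f x μ ν := Finset.sum_congr rfl fun μ _ => Finset.sum_comm

omit [AddCommGroup Λ] in
/-- sum bookkeeping `Σ_x Σ_μ = Σ_μ Σ_x`. [folklore] -/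
theorem sum_x_comm₂ (f : Λ → D → V) : ∑ x, ∑ μ, f x μ = ∑ μ, ∑ x, f x μ := Finset.sum_comm

omit [Fintype Λ] [AddCommGroup Λ] in
/-- sum bookkeeping: renaming the direction pair, `Σ_μ Σ_ν g ν μ = Σ_μ Σ_ν g μ ν`. [folklore] -/
theorem sum_pair_swap (g : D → D → V) : ∑ μ, ∑ ν, g ν μ = ∑ μ, ∑ ν, g μ ν := Finset.sum_comm

omit [Fintype Λ] [Fintype D] in
/-- `x + a + b − a = x + b` in the lattice. [folklore] -/
theorem shift_cancel (x a b : Λ) : x + a + b - a = x + b := by abel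

/-- STEP 1 (antisymmetry of `Z`): `transportMin = 2•pairMin`. [folklore] -/
theorem transportMin_eq_two_pairMin (τ : 𝔸 →ₗ[𝕜] V) (e : D → Λ) (W B : Λ → D → 𝔸) :
    transportMin τ e W B = 2 • pairMin τ e W B := by
  have h : ∀ x, ∑ μ, ∑ ν, τ (lcurl e W x μ ν * br (B x ν) (W (x + e ν) μ)) =
      -∑ μ, ∑ ν, τ (lcurl e W x μ ν * br (B x μ) (W (x + e μ) ν)) := by
    intro x
    rw [← sum_pair_swap (fun μ ν => τ (lcurl e W x μ ν * br (B x ν) (W (x + e ν) μ))), ← Finset.sum_neg_distrib]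
    refine Finset.sum_congr rfl fun μ _ => ?_
    rw [← Finset.sum_neg_distrib]
    refine Finset.sum_congr rfl fun ν _ => ?_
    show τ (lcurl e W x ν μ * br (B x μ) (W (x + e μ) ν)) = _
    rw [lcurl_swap e W x μ ν, neg_mul, map_neg]
  simp only [transportMin, pairMin, covCurlGerm, mul_sub, map_sub, Finset.sum_sub_distrib, h, sub_neg_eq_add, two_nsmul,
    Finset.sum_add_distrib]

/-- STEP 2 (`Z = δ_μW_ν − δ_νW_μ`): `pairMin = gradGerm − crossGerm`. [folklore] -/
theorem pairMin_eq (τ : 𝔸 →ₗ[𝕜] V) (e : D → Λ) (W B : Λ → D → 𝔸) :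
    pairMin τ e W B = gradGerm τ e W B - crossGerm τ e W B := by
  simp only [pairMin, gradGerm, crossGerm, ← Finset.sum_sub_distrib, ← map_sub, ← sub_mul, lcurl]

/-- STEP 3 (summation by parts `x ↦ x + e_ν`, Leibniz, cyclicity): `crossGerm = −halfSpin − longCross`. [folklore] -/
theorem crossGerm_eq (τ : 𝔸 →ₗ[𝕜] V) (hτ : ∀ a b : 𝔸, τ (a * b) = τ (b * a)) (e : D → Λ) (W B : Λ → D → 𝔸) :
    crossGerm τ e W B = -halfSpin τ e W B - longCross τ e W B := by
  -- the longitudinal slice, expanded over `ν` and reordered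
  have hL : longCross τ e W B =
      ∑ μ, ∑ ν, ∑ x, τ (W x μ * br (B x μ) (W (x + e μ) ν - W (x + e μ - e ν) ν)) := by
    rw [longCross, sum_x_comm₂]
    refine Finset.sum_congr rfl fun μ _ => ?_
    calc ∑ x, τ (W x μ * br (B x μ) (divW e W (x + e μ)))
        = ∑ x, ∑ ν, τ (W x μ * br (B x μ) (W (x + e μ) ν - W (x + e μ - e ν) ν)) := by
          refine Finset.sum_congr rfl fun x _ => ?_
          rw [divW, br_sum_right, Finset.mul_sum, map_sum]
      _ = ∑ ν, ∑ x, τ (W x μ * br (B x μ) (W (x + e μ) ν - W (x + e μ - e ν) ν)) := Finset.sum_comm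
  rw [hL, crossGerm, halfSpin, sum_x_comm₃, sum_x_comm₃ (fun x μ ν => τ ((B (x + e ν) μ - B x μ) * _)),
    ← Finset.sum_neg_distrib, ← Finset.sum_sub_distrib]
  refine Finset.sum_congr rfl fun μ _ => ?_
  rw [← Finset.sum_neg_distrib, ← Finset.sum_sub_distrib]
  refine Finset.sum_congr rfl fun ν _ => ?_
  -- the slice at fixed `(μ, ν)`: split the longitudinal summand and reindex its second half by `x ↦ x + e_ν`
  have hsplit : ∑ x, τ (W x μ * br (B x μ) (W (x + e μ) ν - W (x + e μ - e ν) ν)) =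
      ∑ x, τ (W x μ * br (B x μ) (W (x + e μ) ν)) - ∑ x, τ (W (x + e ν) μ * br (B (x + e ν) μ) (W (x + e μ) ν)) := by
    simp only [br_sub_right, mul_sub, map_sub, Finset.sum_sub_distrib]
    congr 1
    rw [← sum_shift (e ν) (fun x => τ (W x μ * br (B x μ) (W (x + e μ - e ν) ν)))]
    simp only [shift_cancel]
  rw [hsplit, ← Finset.sum_sub_distrib, ← Finset.sum_neg_distrib, ← Finset.sum_sub_distrib]
  refine Finset.sum_congr rfl fun x _ => ?_
  exact trace_cross_pointwise τ hτ (W x μ) (W (x + e ν) μ) (B x μ) (B (x + e ν) μ) (W (x + e μ) ν)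

/-- STEP 4 (reindex `x ↦ x + e_μ`, cyclicity): `longCross = −divGerm`. [folklore] -/
theorem longCross_eq (τ : 𝔸 →ₗ[𝕜] V) (hτ : ∀ a b : 𝔸, τ (a * b) = τ (b * a)) (e : D → Λ) (W B : Λ → D → 𝔸) :
    longCross τ e W B = -divGerm τ e W B := by
  have hD : divGerm τ e W B = ∑ μ, ∑ x, τ (divW e W (x + e μ) * br (B x μ) (W x μ)) := by
    calc divGerm τ e W B = ∑ x, ∑ μ, τ (divW e W x * br (B (x - e μ) μ) (W (x - e μ) μ)) := by
          refine Finset.sum_congr rfl fun x _ => ?_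
          rw [divTwist, Finset.mul_sum, map_sum]
      _ = ∑ μ, ∑ x, τ (divW e W x * br (B (x - e μ) μ) (W (x - e μ) μ)) := Finset.sum_comm
      _ = ∑ μ, ∑ x, τ (divW e W (x + e μ) * br (B x μ) (W x μ)) := by
          refine Finset.sum_congr rfl fun μ _ => ?_
          rw [← sum_shift (e μ) (fun x => τ (divW e W x * br (B (x - e μ) μ) (W (x - e μ) μ)))]
          simp only [add_sub_cancel_right]
  rw [hD, longCross, sum_x_comm₂, ← Finset.sum_neg_distrib]
  refine Finset.sum_congr rfl fun μ _ => ?_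
  rw [← Finset.sum_neg_distrib]
  refine Finset.sum_congr rfl fun x _ => ?_
  rw [trace_mul_br_cycl τ hτ (W x μ), trace_mul_br_cycl τ hτ (divW e W (x + e μ)), br_swap (divW e W (x + e μ)) (W x μ),
    mul_neg, map_neg, neg_neg]

/-- STEP 5 (antisymmetrisation in the direction pair): `2•halfSpin = spinFar`. [folklore] -/
theorem two_halfSpin (τ : 𝔸 →ₗ[𝕜] V) (e : D → Λ) (W B : Λ → D → 𝔸) :
    2 • halfSpin τ e W B = spinFar τ e W B := by
  have hswap : halfSpin τ e W B =
      ∑ x, ∑ μ, ∑ ν, τ ((B (x + e μ) ν - B x ν) * br (W (x + e ν) μ) (W (x + e μ) ν)) := by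
    refine Finset.sum_congr rfl fun x _ => ?_
    exact sum_pair_swap (fun μ ν => τ ((B (x + e μ) ν - B x ν) * br (W (x + e ν) μ) (W (x + e μ) ν)))
  rw [two_nsmul]
  conv_lhs => rw [hswap]; arg 1; rw [← hswap]  -- keep one copy in each form
  rw [halfSpin, spinFar, ← Finset.sum_add_distrib]
  refine Finset.sum_congr rfl fun x _ => ?_
  rw [← Finset.sum_add_distrib]
  refine Finset.sum_congr rfl fun μ _ => ?_
  rw [← Finset.sum_add_distrib]
  refine Finset.sum_congr rfl fun ν _ => ?_
  rw [trace_antisymm_pointwise, lcurl]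

/-- **THE LATTICE WEITZENBÖCK IDENTITY AT `B`-LINEAR ORDER.**  On a finite periodic lattice, for a tracial functional `τ`, EVERY
fluctuation `W`, background `B` and frame `e`:
`transportMin τ e W B = 2•gradGerm τ e W B − 2•divGerm τ e W B + spinFar τ e W B` — the `B`-linear germ of half the square of the
covariant curl is twice the covariant-gradient germ minus twice the covariant-divergence germ plus ONE unit of the far-corner spin
form.  Exact: no lattice remainder at this level. [folklore] -/
theorem transportMin_eq (τ : 𝔸 →ₗ[𝕜] V) (hτ : ∀ a b : 𝔸, τ (a * b) = τ (b * a)) (e : D → Λ) (W B : Λ → D → 𝔸) :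
    transportMin τ e W B = 2 • gradGerm τ e W B - 2 • divGerm τ e W B + spinFar τ e W B := by
  rw [transportMin_eq_two_pairMin, pairMin_eq, crossGerm_eq τ hτ, longCross_eq τ hτ, ← two_halfSpin]
  abel

/-- **THE TRANSPORT FORM OF THE WILSON JET, REWRITTEN**: `transport = 2•gradGerm − 2•divGerm + spinFar − transportF`. [folklore] -/
theorem transport_weitzenbock (τ : 𝔸 →ₗ[𝕜] V) (hτ : ∀ a b : 𝔸, τ (a * b) = τ (b * a)) (e : D → Λ) (W B : Λ → D → 𝔸) :
    transport τ e W B = 2 • gradGerm τ e W B - 2 • divGerm τ e W B + spinFar τ e W B - transportF τ e W B := by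
  rw [transport_split, transportMin_eq τ hτ]

/-! ### the germs ARE the cross terms of the squares of the first-order covariant objects -/

/-- THE FIRST-ORDER COVARIANT FORWARD DIFFERENCE of the component `W_ν` along `μ`: `W_ν(x+e_μ) − W_ν(x) + [B_μ(x), W_ν(x+e_μ)]`
(transport from `b₊` back to `b₋`, B9 p. 390; `B8CurlGradHolonomy.covD` at first order in `U = e^B`; context). [folklore] -/
def covGrad₁ (e : D → Λ) (W B : Λ → D → 𝔸) (x : Λ) (μ ν : D) : 𝔸 :=
  (W (x + e μ) ν - W x ν) + br (B x μ) (W (x + e μ) ν)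

/-- THE FIRST-ORDER COVARIANT CURL `Z_{μν}(x) + covCurlGerm` (B9 (3.4) at first order; context). [folklore] -/
def covCurl₁ (e : D → Λ) (W B : Λ → D → 𝔸) (x : Λ) (μ ν : D) : 𝔸 :=
  lcurl e W x μ ν + covCurlGerm e W B x μ ν

/-- THE FIRST-ORDER COVARIANT DIVERGENCE `divW(x) + divTwist(x)` (= `−(D*A)(x)` of B9 (3.8) at first order in `U = e^B`, `η = 1`:
«R(U(x, x − e_μ))A(x − e_μ, x) − A(x, x + e_μ)» with `R(U(x, x−e_μ)) = R(e^{B_μ(x−e_μ)})⁻¹ = 1 − [B_μ(x−e_μ), ·] + …`; context). [folklore] -/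
def covDiv₁ (e : D → Λ) (W B : Λ → D → 𝔸) (x : Λ) : 𝔸 := divW e W x + divTwist e W B x

omit [Fintype Λ] [Fintype D] in
/-- the first-order covariant curl is the antisymmetrised first-order covariant gradient (B9 p. 391: `(D_{U₀}A)_{μν} = D_{U₀,μ}A_ν − D_{U₀,ν}A_μ`,
first order). [folklore] -/
theorem covCurl₁_eq (e : D → Λ) (W B : Λ → D → 𝔸) (x : Λ) (μ ν : D) :
    covCurl₁ e W B x μ ν = covGrad₁ e W B x μ ν - covGrad₁ e W B x ν μ := by
  simp only [covCurl₁, covGrad₁, covCurlGerm, lcurl]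
  abel

/-- `Σ τ(covCurl₁²) = Σ τ(Z²) + 2•transportMin + Σ τ(covCurlGerm²)`: `transportMin` IS the `B`-linear germ of `½Σ τ((D_{U₀}W)²_{μν})`.
[folklore] -/
theorem sum_covCurl₁_sq (τ : 𝔸 →ₗ[𝕜] V) (hτ : ∀ a b : 𝔸, τ (a * b) = τ (b * a)) (e : D → Λ) (W B : Λ → D → 𝔸) :
    (∑ x, ∑ μ, ∑ ν, τ (covCurl₁ e W B x μ ν * covCurl₁ e W B x μ ν)) =
      (∑ x, ∑ μ, ∑ ν, τ (lcurl e W x μ ν * lcurl e W x μ ν)) + 2 • transportMin τ e W B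
        + ∑ x, ∑ μ, ∑ ν, τ (covCurlGerm e W B x μ ν * covCurlGerm e W B x μ ν) := by
  simp only [covCurl₁, trace_sq_add τ hτ, transportMin, Finset.sum_add_distrib, Finset.smul_sum]

/-- `Σ τ(covGrad₁²) = Σ τ((δW)²) + 2•gradGerm + Σ τ(germ²)`: `gradGerm` IS the `B`-linear germ of `½Σ_{x,μ,ν} τ((∇_{U₀,μ}W_ν)²)`. [folklore] -/
theorem sum_covGrad₁_sq (τ : 𝔸 →ₗ[𝕜] V) (hτ : ∀ a b : 𝔸, τ (a * b) = τ (b * a)) (e : D → Λ) (W B : Λ → D → 𝔸) :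
    (∑ x, ∑ μ, ∑ ν, τ (covGrad₁ e W B x μ ν * covGrad₁ e W B x μ ν)) =
      (∑ x, ∑ μ, ∑ ν, τ ((W (x + e μ) ν - W x ν) * (W (x + e μ) ν - W x ν))) + 2 • gradGerm τ e W B
        + ∑ x, ∑ μ, ∑ ν, τ (br (B x μ) (W (x + e μ) ν) * br (B x μ) (W (x + e μ) ν)) := by
  simp only [covGrad₁, trace_sq_add τ hτ, gradGerm, Finset.sum_add_distrib, Finset.smul_sum]

/-- `Σ τ(covDiv₁²) = Σ τ(divW²) + 2•divGerm + Σ τ(divTwist²)`: `divGerm` IS the `B`-linear germ of `½Σ_x τ((div_{U₀}W)²)`. [folklore] -/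
theorem sum_covDiv₁_sq (τ : 𝔸 →ₗ[𝕜] V) (hτ : ∀ a b : 𝔸, τ (a * b) = τ (b * a)) (e : D → Λ) (W B : Λ → D → 𝔸) :
    (∑ x, τ (covDiv₁ e W B x * covDiv₁ e W B x)) =
      (∑ x, τ (divW e W x * divW e W x)) + 2 • divGerm τ e W B + ∑ x, τ (divTwist e W B x * divTwist e W B x) := by
  simp only [covDiv₁, trace_sq_add τ hτ, divGerm, Finset.sum_add_distrib, Finset.smul_sum]

/-! ### the gradient germ at a one-bond background is a pure hopping term -/

/-- **THE GRADIENT GERM AT THE ONE-BOND BACKGROUND `(z, γ, Y)`** (ring level, `τ` tracial, every `W`):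
`gradGerm τ e W (bondLetter z γ Y) = Σ_ν τ(Y·[W_ν(z), W_ν(z+e_γ)])` — hopping across the background bond, diagonal in the component
index `ν`, no on-site term (`τ(W′·[Y, W′]) = 0`). [folklore] -/
theorem gradGerm_bondLetter [DecidableEq Λ] [DecidableEq D] (τ : 𝔸 →ₗ[𝕜] V) (hτ : ∀ a b : 𝔸, τ (a * b) = τ (b * a)) (e : D → Λ)
    (W : Λ → D → 𝔸) (z : Λ) (γ : D) (Y : 𝔸) :
    gradGerm τ e W (bondLetter z γ Y) = ∑ ν, τ (Y * br (W z ν) (W (z + e γ) ν)) := by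
  rw [gradGerm, Finset.sum_eq_single_of_mem z (Finset.mem_univ z)]
  · rw [Finset.sum_eq_single_of_mem γ (Finset.mem_univ γ)]
    · refine Finset.sum_congr rfl fun ν _ => ?_
      rw [bondLetter, if_pos ⟨rfl, rfl⟩, sub_mul, map_sub, trace_mul_br_self τ hτ, zero_sub, trace_mul_br_cycl τ hτ (W z ν),
        br_swap (W z ν), mul_neg, map_neg, neg_neg]
    · intro μ _ hμ
      simp only [bondLetter, hμ, and_false, ↓reduceIte, br_zero_left, mul_zero, map_zero, Finset.sum_const_zero]
  · intro x _ hx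
    simp only [bondLetter, hx, false_and, ↓reduceIte, br_zero_left, mul_zero, map_zero, Finset.sum_const_zero]

end Forms

/-! ### the Wilson jet rewritten (normed letters, `𝕜 = ℝ` or `ℂ`) -/

section Words

variable (𝕜 : Type*) [RCLike 𝕜] {𝔸 : Type*} [NormedRing 𝔸] [NormedAlgebra 𝕜 𝔸]
variable {V : Type*} [AddCommGroup V] [Module 𝕜 V]
variable {Λ : Type*} [Fintype Λ] [AddCommGroup Λ] {D : Type*} [Fintype D]

/-- **THE WILSON `(2,1)`-JET AFTER THE WEITZENBÖCK REWRITING**: for tracial `τ`,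
`jet21 = spinLocal + spinFar + ½•spinDiff + 2•gradGerm − 2•divGerm − transportF` — TWO spin forms, coefficient ONE each (the explicit
plaquette-commutator unit `spinLocal` of `PlaquetteVertex.jet21_split` and the Weitzenböck unit `spinFar`), the covariant-gradient germ,
the longitudinal germ, and two explicit forms of grading (t) two. [folklore] -/
theorem jet21_weitzenbock (τ : 𝔸 →ₗ[𝕜] V) (hτ : ∀ a b : 𝔸, τ (a * b) = τ (b * a)) (e : D → Λ) (W B : Λ → D → 𝔸) :
    jet21 𝕜 τ e W B = spinLocal τ e W B + spinFar τ e W B + (2 : 𝕜)⁻¹ • spinDiff τ e W B + 2 • gradGerm τ e W B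
      - 2 • divGerm τ e W B - transportF τ e W B := by
  rw [jet21_split 𝕜 τ hτ, transport_weitzenbock τ hτ]
  abel

end Words

/-! ## §3 In `SpinTable`'s coordinates: the gradient germ is `−½·vᵀ current(copies) v`; the jet is `½·vᵀ vecVertex(−2) v + divGerm + R` -/

section Coordinates

variable {𝔸 : Type*} [Ring 𝔸] [Algebra ℝ 𝔸]
variable {Λ : Type*} [Fintype Λ] [DecidableEq Λ] [AddCommGroup Λ] {C : Type*} [Fintype C] [DecidableEq C]
  {D : Type*} [Fintype D] [DecidableEq D]

omit [AddCommGroup Λ] [Fintype C] [DecidableEq C] [Fintype D] [DecidableEq D] in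
/-- the bilinear form of an elementary insertion: `v ⬝ᵥ (elemIns x y m) w = Σ_p Σ_q v(x,p)·m_{pq}·w(y,q)`. [folklore] -/
theorem dotProduct_elemIns_mulVec {C' : Type*} [Fintype C'] (x y : Λ) (m : Matrix C' C' ℝ) (v w : Λ × C' → ℝ) :
    v ⬝ᵥ (elemIns x y m *ᵥ w) = ∑ p, ∑ q, v (x, p) * m p q * w (y, q) := by
  simp only [dotProduct, Matrix.mulVec, Fintype.sum_prod_type]
  rw [Finset.sum_eq_single_of_mem x (Finset.mem_univ x)]
  · refine Finset.sum_congr rfl fun p _ => ?_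
    rw [Finset.sum_eq_single_of_mem y (Finset.mem_univ y)]
    · rw [Finset.mul_sum]
      refine Finset.sum_congr rfl fun q _ => ?_
      rw [elemIns_apply, if_pos ⟨rfl, rfl⟩]
      ring
    · intro u _ hu
      simp only [elemIns_apply, hu, and_false, ↓reduceIte, zero_mul, Finset.sum_const_zero]
  · intro u _ hu
    have : ∀ p, (∑ u', ∑ q, elemIns x y m (u, p) (u', q) * w (u', q)) = 0 := fun p => by
      refine Finset.sum_eq_zero fun u' _ => Finset.sum_eq_zero fun q _ => ?_
      rw [elemIns_apply, if_neg (fun h : u = x ∧ u' = y => hu h.1), zero_mul]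
    simp only [this, mul_zero, Finset.sum_const_zero]

omit [Fintype C] [DecidableEq C] [Fintype D] in
/-- entries of the copies `A ⊗ 1_D`: `copies D A (a,k) (b,k′) = [k = k′]·A a b`. [folklore] -/
theorem copies_apply (A : Matrix C C ℝ) (a b : C) (k k' : D) :
    copies D A (a, k) (b, k') = if k = k' then A a b else 0 := by
  simp only [copies, Matrix.blockDiagonal_apply]

omit [AddCommGroup Λ] [DecidableEq C] in
/-- the bilinear form of an elementary insertion of the copies: `v ⬝ᵥ (elemIns x y (copies D A)) w = Σ_k Σ_a Σ_b v(x,(a,k))·A a b·w(y,(b,k))`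
(diagonal in the component index). [folklore] -/
theorem dotProduct_elemIns_copies_mulVec (x y : Λ) (A : Matrix C C ℝ) (v w : Λ × (C × D) → ℝ) :
    v ⬝ᵥ (elemIns x y (copies D A) *ᵥ w) = ∑ k, ∑ a, ∑ b, v (x, (a, k)) * A a b * w (y, (b, k)) := by
  rw [dotProduct_elemIns_mulVec]
  simp only [Fintype.sum_prod_type, copies_apply, mul_ite, mul_zero, ite_mul, zero_mul, Finset.sum_ite_eq,
    Finset.mem_univ, if_true]
  -- `Σ_a Σ_k Σ_b = Σ_k Σ_a Σ_b`
  exact Finset.sum_comm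

omit [DecidableEq C] in
/-- **THE GRADIENT GERM IS THE CURRENT OF THE COPIES.**  At the one-bond background `(z, γ, Y)`, for every fluctuation in coordinates
`v` and tracial `τ`: `gradGerm τ e (field t v) (bondLetter z γ Y) = −½·v ⬝ᵥ (GhostTable.current z (e γ) (copies D (adM Y)) *ᵥ v)` — the
antisymmetric lattice current across the background bond of the `card D` copies of the colour matrix `adM Y`: the FIRST summand of
`SpinTable.vecVertex`. [folklore] -/
theorem gradGerm_field_bondLetter (τ : 𝔸 →ₗ[ℝ] ℝ) (hτ : ∀ a b : 𝔸, τ (a * b) = τ (b * a)) (t : C → 𝔸) (e : D → Λ)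
    (v : Λ × (C × D) → ℝ) (z : Λ) (γ : D) (Y : 𝔸) :
    gradGerm τ e (field t v) (bondLetter z γ Y) =
      -((2 : ℝ)⁻¹ * (v ⬝ᵥ (current z (e γ) (copies D (adM τ t Y)) *ᵥ v))) := by
  -- the hopping sum `S = Σ_k Σ_a Σ_b v(z,(a,k))·A a b·v(z+e_γ,(b,k))`
  have hS : gradGerm τ e (field t v) (bondLetter z γ Y) =
      ∑ k, ∑ a, ∑ b, v (z, (a, k)) * adM τ t Y a b * v (z + e γ, (b, k)) := by
    rw [gradGerm_bondLetter τ hτ]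
    refine Finset.sum_congr rfl fun k _ => ?_
    simp only [field, trace_mul_br_sum]
    refine Finset.sum_congr rfl fun a _ => Finset.sum_congr rfl fun b _ => ?_
    ring
  -- the reversed hopping is minus the direct one (antisymmetry of `adM`)
  have hR : (∑ k, ∑ a, ∑ b, v (z + e γ, (a, k)) * adM τ t Y a b * v (z, (b, k))) =
      -∑ k, ∑ a, ∑ b, v (z, (a, k)) * adM τ t Y a b * v (z + e γ, (b, k)) := by
    rw [← Finset.sum_neg_distrib]
    refine Finset.sum_congr rfl fun k _ => ?_
    rw [Finset.sum_comm, ← Finset.sum_neg_distrib]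
    refine Finset.sum_congr rfl fun a _ => ?_
    rw [← Finset.sum_neg_distrib]
    refine Finset.sum_congr rfl fun b _ => ?_
    rw [adM_antisymm τ t Y a b]
    ring
  rw [hS, current, Matrix.sub_mulVec, dotProduct_sub, dotProduct_elemIns_copies_mulVec, dotProduct_elemIns_copies_mulVec, hR]
  ring

end Coordinates

section CoordinatesNormed

variable {𝔸 : Type*} [NormedRing 𝔸] [NormedAlgebra ℝ 𝔸]
variable {Λ : Type*} [Fintype Λ] [DecidableEq Λ] [AddCommGroup Λ] {C : Type*} [Fintype C] [DecidableEq C]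
  {D : Type*} [Fintype D] [DecidableEq D]

/-- THE TOTAL SPIN COUPLING DERIVED FROM THE WILSON ACTION: `−2`. [folklore] -/
def sTot : ℝ := -2

/-- THE REMAINDER of grading (t) ≥ 2 in the headline: `R = −¼·spinDiff + ½·transportF − ½·spinFarDiff` (explicit forms; not estimated).
[folklore] -/
noncomputable def remainder (τ : 𝔸 →ₗ[ℝ] ℝ) (e : D → Λ) (W B : Λ → D → 𝔸) : ℝ :=
  -((4 : ℝ)⁻¹ * spinDiff τ e W B) + (2 : ℝ)⁻¹ * transportF τ e W B - (2 : ℝ)⁻¹ * spinFarDiff τ e W B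

omit [DecidableEq C] in
/-- **HEADLINE — THE WILSON ACTION'S `B`-LINEAR ONE-BOND HESSIAN GERM IS `SpinTable`'S MODEL VECTOR VERTEX AT `s = −2`.**  In the
Hessian convention `S₂ = ½·vᵀHv` for `S = Σ_p (1 − Re τU(∂p))` (`(2,1)`-jet `= −½·jet21`, `PlaquetteVertex` header), at the one-bond
background `(z, γ, Y)`, for EVERY fluctuation in coordinates `v` and tracial `τ`:
`−½·jet21 = ½·v ⬝ᵥ (vecVertex sTot e z γ (adM Y) *ᵥ v) + divGerm + remainder`, `sTot = −2` — `SpinTable.vecVertex s =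
current(copies) + s•spinVertex` with BOTH spin units present (`−1` explicit, `−1` Weitzenböck), modulo the longitudinal germ (gauge
fixing's business, B9 (3.26); separated, not eliminated) and the explicit grading-(t)-two remainder. [folklore] -/
theorem actionJet21_eq_vecVertex (τ : 𝔸 →ₗ[ℝ] ℝ) (hτ : ∀ a b : 𝔸, τ (a * b) = τ (b * a)) (t : C → 𝔸) (e : D → Λ)
    (v : Λ × (C × D) → ℝ) (z : Λ) (γ : D) (Y : 𝔸) :
    -((2 : ℝ)⁻¹ * jet21 ℝ τ e (field t v) (bondLetter z γ Y)) =
      (2 : ℝ)⁻¹ * (v ⬝ᵥ (vecVertex sTot e z γ (adM τ t Y) *ᵥ v))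
        + divGerm τ e (field t v) (bondLetter z γ Y) + remainder τ e (field t v) (bondLetter z γ Y) := by
  rw [jet21_weitzenbock ℝ τ hτ, spinFar_eq, spinLocal_field_bondLetter, gradGerm_field_bondLetter τ hτ, remainder, sTot, vecVertex,
    Matrix.add_mulVec, dotProduct_add, Matrix.smul_mulVec, dotProduct_smul]
  simp only [smul_eq_mul, nsmul_eq_mul, Nat.cast_ofNat]
  ring

omit [DecidableEq C] in
/-- the same with the spin coupling displayed: `−½·jet21 = ½·vᵀ(current(copies (adM Y)))v + ½·sTot·vᵀ(spinVertex (adM Y))v + divGerm + R`.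
[folklore] -/
theorem actionJet21_eq_current_add_spin (τ : 𝔸 →ₗ[ℝ] ℝ) (hτ : ∀ a b : 𝔸, τ (a * b) = τ (b * a)) (t : C → 𝔸) (e : D → Λ)
    (v : Λ × (C × D) → ℝ) (z : Λ) (γ : D) (Y : 𝔸) :
    -((2 : ℝ)⁻¹ * jet21 ℝ τ e (field t v) (bondLetter z γ Y)) =
      (2 : ℝ)⁻¹ * (v ⬝ᵥ (current z (e γ) (copies D (adM τ t Y)) *ᵥ v))
        + (2 : ℝ)⁻¹ * sTot * (v ⬝ᵥ (spinVertex e z γ (adM τ t Y) *ᵥ v))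
        + divGerm τ e (field t v) (bondLetter z γ Y) + remainder τ e (field t v) (bondLetter z γ Y) := by
  rw [actionJet21_eq_vecVertex τ hτ, vecVertex, Matrix.add_mulVec, dotProduct_add, Matrix.smul_mulVec, dotProduct_smul, smul_eq_mul]
  ring

end CoordinatesNormed

/-! ## §4 Bałaban's letters (`𝔸 = Mat_N(ℂ)`, `τ = Re tr` normalised, `t_c = iτ_c`): the colour matrix is `ColourTrace.adMat`, and
`SpinTable.three_sectors_bf` holds with the DERIVED coupling -/

section BalabanLetters

open ColourTrace

attribute [local instance] Matrix.linftyOpNormedRing Matrix.linftyOpNormedAlgebra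

variable {N : ℕ} {C : Type*} [Fintype C] [DecidableEq C]
variable {Λ : Type*} [Fintype Λ] [DecidableEq Λ] [AddCommGroup Λ] {D : Type*} [Fintype D] [DecidableEq D]

omit [DecidableEq C] in
/-- **BAŁABAN'S LETTERS VERBATIM**: `−½·jet21 = ½·v ⬝ᵥ (vecVertex sTot e z γ (ColourTrace.adMat τ (τ_c)) *ᵥ v) + divGerm + R` — the model
vector vertex of `SpinTable.three_sectors_gen` with its very colour matrix, at the derived `sTot = −2` (no hypothesis on the generator
family; the norm instance is any submultiplicative matrix norm, enabled locally as in `PlaquetteVertex` §4). [folklore] -/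
theorem actionJet21_eq_vecVertex_gen (τ : C → Matrix (Fin N) (Fin N) ℂ) (e : D → Λ) (v : Λ × (C × D) → ℝ) (z : Λ) (γ : D)
    (c : C) :
    -((2 : ℝ)⁻¹ * jet21 ℝ rntr e (field (gen τ) v) (bondLetter z γ (gen τ c))) =
      (2 : ℝ)⁻¹ * (v ⬝ᵥ (vecVertex sTot e z γ (adMat τ (τ c)) *ᵥ v))
        + divGerm rntr e (field (gen τ) v) (bondLetter z γ (gen τ c))
        + remainder rntr e (field (gen τ) v) (bondLetter z γ (gen τ c)) := by
  rw [actionJet21_eq_vecVertex rntr rntr_comm (gen τ) e v z γ (gen τ c), adM_gen]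

/-- **THE REALISED TABLE FROM THE DERIVED COUPLING**: `SpinTable.three_sectors_bf` — `½·bubble_vec − bubble_ghost = bfKernel g N e_μ e_ν v`
at `card D = 4` — holds verbatim with `vecVertex sTot` in place of `vecVertex 2` (`sTot² = 4`: the table sees the square only,
`SpinTable.coeff_sq_iff`). [folklore] -/
theorem three_sectors_bf_sTot {τ : C → Matrix (Fin N) (Fin N) ℂ} (hD : Fintype.card D = 4) (hτ : Complete τ)
    (ho : TrOrthonormal τ) (hH : ∀ c, (τ c).IsHermitian) (hN : N ≠ 0) {g : Λ → ℝ} (hg : ∀ v, g (-v) = g v) {μ ν : D}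
    (hμν : μ ≠ ν) (e : D → Λ) (z v : Λ) (a : C) :
    (1 / 2 : ℝ) * Matrix.trace (convKernel g * vecVertex sTot e z μ (adMat τ (τ a)) *
          (convKernel g * vecVertex sTot e (z + (v + e μ)) ν (adMat τ (τ a))))
        - Matrix.trace (convKernel g * current z (e μ) (adMat τ (τ a)) *
          (convKernel g * current (z + (v + e μ)) (e ν) (adMat τ (τ a)))) =
      bfKernel g N (e μ) (e ν) v := by
  rw [three_sectors_gen hτ ho hH hN hg hμν, hD, bfKernel_eq_model, sTot]
  norm_num

end BalabanLetters

/-! ## §5 Coefficient bookkeeping: both units derived -/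

section Bookkeeping

/-- THE WEITZENBÖCK SPIN COUPLING: `−1` (the coefficient of `spinFar` in `jet21_weitzenbock` is `+1`, as that of `spinLocal`; in the
Hessian convention `−½·jet21 = ½·vᵀ(s•spinVertex)v + …` each contributes `−1`). [folklore] -/
def sW : ℝ := -1

/-- `sTot = sExpl + sW`: the explicit unit of `PlaquetteVertex` plus the Weitzenböck unit of this file. [folklore] -/
theorem sTot_eq : sTot = sExpl + sW := by norm_num [sTot, sExpl, sW]

/-- `sTot² = 4`. [folklore] -/
theorem sTot_sq : sTot ^ 2 = 4 := by norm_num [sTot]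

/-- **THE DERIVED COUPLING REPRODUCES THE TABLE'S SQUARE COEFFICIENT**: `2N²·sTot² = 8N²` (`SpinTable.coeff_sq_iff`;
`PlaquetteVertex.coeff_sq_two_units` realised). [folklore] -/
theorem coeff_sq_sTot {N : ℝ} (hN : N ≠ 0) : 2 * N ^ 2 * sTot ^ 2 = 8 * N ^ 2 := by
  rw [coeff_sq_iff hN, sTot_sq]

end Bookkeeping

/-! ## Examples -/

section Examples

/-- the derived coupling against the realised table at `N = 3`: `2·9·4 = 72`. [folklore] -/
example : 2 * (3 : ℝ) ^ 2 * sTot ^ 2 = 8 * (3 : ℝ) ^ 2 := coeff_sq_sTot (by norm_num)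

/-- the Leibniz rule and the far bracket in the free ring on letters (any ring). [folklore] -/
example {R : Type*} [Ring R] (B B' U U' : R) : br B' U' - br B U = br (B' - B) U + br B' (U' - U) := br_sub_br B B' U U'

/-- `sTot = sExpl + sW = −1 + −1`. [folklore] -/
example : sTot = -1 + -1 := by norm_num [sTot]

end Examples

end Literature.MathematicalPhysics.QuantumFieldTheory.Balaban1983to89.Beta.PlaquetteWeitzenbock
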